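import Summits.QuantumFields.YangMills.Theorems.ForcedResponseSkewnessRunningCouplingCeilingSmearToolkit
import HarnessLib

/-!
# Crux `RunningCouplingCeiling` (stmt-QuantumFields-23617), line `pointwise-log-ceiling`: the four pair classes of the
# smearing stub (pure real arithmetic)

Support file (`--supports stmt-QuantumFields-23617`, helper) of the lead prover of route `ForcedResponseSkewness` (unit
`ym-line-frs-p1`).  For one pair of lattice sites the smeared term is `θv(u) v(w) K(x,y)`; after wall flatness
(`|θv(u)||v(w)| ≤ B² P b₁ b₂`, `P = φ(|u₀|)⁸φ(w₀)⁸ ≤ σ⁸, σ¹⁶, 1`, `bᵢ = (1+‖·‖)^{-16} ≤ cᵢ = (1+‖·‖)^{-8}`) and no wrap-around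
(`σ ≤ s d`, `d` the torus distance), the kernel bounds of `KernelBounds` give four pair-independent weights:

* `est_contact` — `d < n₀`: `P b₁b₂ |k| ≤ C₂ n₀¹⁶ s¹⁶ · c₁c₂`;
* `est_infrared` — `t d > 1/2`: `≤ 2⁸ C₁ t⁸ · c₁c₂`;
* `est_window` — `t d ≤ 1/2`, `t d ≤ 1/√Λ`: `≤ 4 C₀ s⁸/log²Λ · c₁c₂` (running-coupling clause);
* `est_tail` — scale-free clause and a Schwartz tail `b₁b₂ ≤ (2⁸/Λ⁴) c₁c₂`: `≤ 2⁸ C₁ s⁸/Λ⁴ · c₁c₂`;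

plus the small facts `phi_pow_mul_phi_pow_le`, `phi_pow_le`, `bracket16_le_bracket8`, `bracket16_le_tail`, `log_sq_le_sq`,
`kernel_le_of_pow_mul_le`, `mul_div_pow_le`.

Honest label: bookkeeping for a conditional rung line (leaf R2a `BalabanLadder.NT`); nothing here bears on the Yang–Mills
mass gap, which is NOT proved by this.
-/

set_option autoImplicit false

noncomputable section

namespace Summit.QuantumFields.YangMills.Cruxes.RunningCouplingCeiling.Pointwise

open Set

/-! ### Small real-analysis facts -/

/-- `min(1, max(a,0))⁸ · min(1, max(b,0))⁸ ≤ (a + b)⁸` for `a, b ≥ 0`. [folklore] -/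
theorem phi_pow_mul_phi_pow_le {a b : ℝ} (ha : 0 ≤ a) (hb : 0 ≤ b) :
    (min 1 (max a 0)) ^ 8 * (min 1 (max b 0)) ^ 8 ≤ (a + b) ^ 8 := by
  have h1 : (min 1 (max a 0)) ^ 8 ≤ 1 := pow_le_one₀ (le_min zero_le_one (le_max_right _ _)) (min_le_left _ _)
  have h2 : min 1 (max b 0) ≤ a + b := by
    rw [max_eq_left hb]; exact (min_le_right _ _).trans (by linarith)
  have h3 : (min 1 (max b 0)) ^ 8 ≤ (a + b) ^ 8 :=
    pow_le_pow_left₀ (le_min zero_le_one (le_max_right _ _)) h2 8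
  calc (min 1 (max a 0)) ^ 8 * (min 1 (max b 0)) ^ 8 ≤ 1 * (a + b) ^ 8 :=
        mul_le_mul h1 h3 (pow_nonneg (le_min zero_le_one (le_max_right _ _)) 8) zero_le_one
    _ = (a + b) ^ 8 := one_mul _

/-- `min(1, max(a,0))⁸ ≤ c⁸` when `0 ≤ a ≤ c`. [folklore] -/
theorem phi_pow_le {a c : ℝ} (ha : 0 ≤ a) (hac : a ≤ c) : (min 1 (max a 0)) ^ 8 ≤ c ^ 8 := by
  rw [max_eq_left ha]
  exact pow_le_pow_left₀ (le_min zero_le_one ha) ((min_le_right _ _).trans hac) 8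

/-- `(1+r)^{-16} ≤ (1+r)^{-8}`. [folklore] -/
theorem bracket16_le_bracket8 (r : ℝ) (hr : 0 ≤ r) : ((1 + r) ^ 16)⁻¹ ≤ ((1 + r) ^ 8)⁻¹ := by
  apply inv_anti₀ (by positivity)
  exact pow_le_pow_right₀ (by linarith) (by norm_num)

/-- Tail gain: `(1+r)^{-16} ≤ (1+R)^{-8} (1+r)^{-8}` for `r > R ≥ 0`. [folklore] -/
theorem bracket16_le_tail {r R : ℝ} (hR : 0 ≤ R) (hr : R < r) :
    ((1 + r) ^ 16)⁻¹ ≤ ((1 + R) ^ 8)⁻¹ * ((1 + r) ^ 8)⁻¹ := by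
  rw [show (1 + r) ^ 16 = (1 + r) ^ 8 * (1 + r) ^ 8 by ring, mul_inv]
  have h : ((1 + r) ^ 8)⁻¹ ≤ ((1 + R) ^ 8)⁻¹ :=
    inv_anti₀ (by positivity) (pow_le_pow_left₀ (by linarith) (by linarith) 8)
  exact mul_le_mul_of_nonneg_right h (inv_nonneg.2 (by positivity))

/-- `log²Λ ≤ Λ²` for `Λ ≥ 1`. [folklore] -/
theorem log_sq_le_sq {Λ : ℝ} (hΛ : 1 ≤ Λ) : Real.log Λ ^ 2 ≤ Λ ^ 2 := by
  have h0 : 0 ≤ Real.log Λ := Real.log_nonneg hΛ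
  have h1 : Real.log Λ ≤ Λ := (Real.log_le_sub_one_of_pos (by linarith)).trans (by linarith)
  exact pow_le_pow_left₀ h0 h1 2

/-- From `d⁸ |k| ≤ A` and `0 < σ ≤ s d`: `|k| ≤ A (s/σ)⁸`. [folklore] -/
theorem kernel_le_of_pow_mul_le {d k A σ s : ℝ} (hd : 0 < d) (hσ : 0 < σ) (hσd : σ ≤ s * d) (hA : 0 ≤ A)
    (h : d ^ 8 * |k| ≤ A) : |k| ≤ A * (s / σ) ^ 8 := by
  have h1 : |k| ≤ A / d ^ 8 := by rw [le_div_iff₀ (by positivity), mul_comm]; exact h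
  have h2 : (1 / d) ^ 8 ≤ (s / σ) ^ 8 := by
    apply pow_le_pow_left₀ (by positivity)
    rw [div_le_div_iff₀ hd hσ, one_mul]; exact hσd
  calc |k| ≤ A / d ^ 8 := h1
    _ = A * (1 / d) ^ 8 := by rw [div_pow, one_pow, ← div_eq_mul_one_div]
    _ ≤ A * (s / σ) ^ 8 := mul_le_mul_of_nonneg_left h2 hA

/-- `P (s/σ)⁸ ≤ s⁸` when `P ≤ σ⁸`, `σ > 0`. [folklore] -/
theorem mul_div_pow_le {P σ s : ℝ} (hPσ : P ≤ σ ^ 8) (hσ : 0 < σ) : P * (s / σ) ^ 8 ≤ s ^ 8 := by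
  calc P * (s / σ) ^ 8 ≤ σ ^ 8 * (s / σ) ^ 8 := mul_le_mul_of_nonneg_right hPσ (by positivity)
    _ = s ^ 8 := by rw [div_pow, ← mul_div_assoc, mul_div_cancel_left₀ _ (pow_ne_zero 8 hσ.ne')]

/-! ### The four classes (pure real arithmetic) -/

/-- CONTACT class `d < n₀`: `|k| ≤ C₂` and `σ ≤ s d < s n₀`. [folklore] -/
theorem est_contact {P σ s d k C₂' b₁ b₂ c₁ c₂ : ℝ} {n₀ : ℕ} (hPσ : P ≤ σ ^ 16) (hσ : 0 < σ)
    (hs : 0 < s) (hσd : σ ≤ s * d) (hdn : d < n₀) (hk : |k| ≤ C₂')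
    (hb₁ : b₁ ≤ c₁) (hb₂ : b₂ ≤ c₂) (hb₁0 : 0 ≤ b₁) (hb₂0 : 0 ≤ b₂) :
    P * (b₁ * b₂) * |k| ≤ C₂' * (n₀ : ℝ) ^ 16 * s ^ 16 * (c₁ * c₂) := by
  have hσn : σ ≤ s * n₀ := hσd.trans (mul_le_mul_of_nonneg_left hdn.le hs.le)
  have hP : P ≤ (s * n₀) ^ 16 := hPσ.trans (pow_le_pow_left₀ hσ.le hσn 16)
  have hbb : b₁ * b₂ ≤ c₁ * c₂ := mul_le_mul hb₁ hb₂ hb₂0 (hb₁0.trans hb₁)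
  have hcc : 0 ≤ c₁ * c₂ := mul_nonneg (hb₁0.trans hb₁) (hb₂0.trans hb₂)
  calc P * (b₁ * b₂) * |k| ≤ (s * n₀) ^ 16 * (c₁ * c₂) * C₂' :=
        mul_le_mul (mul_le_mul hP hbb (mul_nonneg hb₁0 hb₂0) (by positivity)) hk (abs_nonneg _)
          (mul_nonneg (by positivity) hcc)
    _ = C₂' * (n₀ : ℝ) ^ 16 * s ^ 16 * (c₁ * c₂) := by ring

/-- INFRARED class `t d > 1/2`: `|k| ≤ C₁/d⁸ ≤ C₁ (2t)⁸`. [folklore] -/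
theorem est_infrared {P t d k C₁' b₁ b₂ c₁ c₂ : ℝ} (hP1 : P ≤ 1) (hd : 0 < d)
    (htd : 1 / 2 < t * d) (hk : d ^ 8 * |k| ≤ C₁') (hC : 0 ≤ C₁')
    (hb₁ : b₁ ≤ c₁) (hb₂ : b₂ ≤ c₂) (hb₁0 : 0 ≤ b₁) (hb₂0 : 0 ≤ b₂) :
    P * (b₁ * b₂) * |k| ≤ 2 ^ 8 * C₁' * t ^ 8 * (c₁ * c₂) := by
  have h2t : 1 / d ≤ 2 * t := by rw [div_le_iff₀ hd]; linarith
  have hkb : |k| ≤ 2 ^ 8 * C₁' * t ^ 8 := by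
    have h1 : |k| ≤ C₁' / d ^ 8 := by rw [le_div_iff₀ (by positivity), mul_comm]; exact hk
    calc |k| ≤ C₁' / d ^ 8 := h1
      _ = C₁' * (1 / d) ^ 8 := by rw [div_pow, one_pow, ← div_eq_mul_one_div]
      _ ≤ C₁' * (2 * t) ^ 8 := mul_le_mul_of_nonneg_left (pow_le_pow_left₀ (by positivity) h2t 8) hC
      _ = 2 ^ 8 * C₁' * t ^ 8 := by ring
  have hbb : b₁ * b₂ ≤ c₁ * c₂ := mul_le_mul hb₁ hb₂ hb₂0 (hb₁0.trans hb₁)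
  have hcc : 0 ≤ c₁ * c₂ := mul_nonneg (hb₁0.trans hb₁) (hb₂0.trans hb₂)
  calc P * (b₁ * b₂) * |k| ≤ 1 * (c₁ * c₂) * (2 ^ 8 * C₁' * t ^ 8) :=
        mul_le_mul (mul_le_mul hP1 hbb (mul_nonneg hb₁0 hb₂0) zero_le_one) hkb (abs_nonneg _)
          (mul_nonneg zero_le_one hcc)
    _ = 2 ^ 8 * C₁' * t ^ 8 * (c₁ * c₂) := by ring

/-- WINDOW class `t d ≤ 1/2`, `t d ≤ 1/√Λ`: the running-coupling clause gives `|k| ≤ 4C₀ (s/σ)⁸/log²Λ` and the flatness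
`P ≤ σ⁸` absorbs `σ^{-8}`. [folklore] -/
theorem est_window {P σ s t d k C₀ C₀' Λ b₁ b₂ c₁ c₂ : ℝ} (hP0 : 0 ≤ P) (hPσ : P ≤ σ ^ 8) (hσ : 0 < σ)
    (hd : 0 < d) (hσd : σ ≤ s * d) (ht : 0 < t) (hΛ : 2 ≤ Λ)
    (htdΛ : t * d ≤ 1 / Real.sqrt Λ) (hk : d ^ 8 * |k| ≤ C₀ / Real.log (1 / (t * d)) ^ 2) (hC : C₀ ≤ C₀')
    (hC0 : 0 ≤ C₀') (hb₁ : b₁ ≤ c₁) (hb₂ : b₂ ≤ c₂) (hb₁0 : 0 ≤ b₁) (hb₂0 : 0 ≤ b₂) :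
    P * (b₁ * b₂) * |k| ≤ 4 * C₀' * s ^ 8 / Real.log Λ ^ 2 * (c₁ * c₂) := by
  have hΛpos : 0 < Λ := by linarith
  have hlog : 0 < Real.log Λ := Real.log_pos (by linarith)
  have hsqrt : 0 < Real.sqrt Λ := Real.sqrt_pos.2 hΛpos
  have htdpos : 0 < t * d := mul_pos ht hd
  have hinv : Real.sqrt Λ ≤ 1 / (t * d) := (le_one_div hsqrt htdpos).2 htdΛ
  have hlog1 : Real.log Λ / 2 ≤ Real.log (1 / (t * d)) := by
    rw [← Real.log_sqrt hΛpos.le]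
    exact Real.log_le_log hsqrt hinv
  have hlog2 : Real.log Λ ^ 2 / 4 ≤ Real.log (1 / (t * d)) ^ 2 := by
    have h0 : 0 ≤ Real.log Λ / 2 := by positivity
    calc Real.log Λ ^ 2 / 4 = (Real.log Λ / 2) ^ 2 := by ring
      _ ≤ Real.log (1 / (t * d)) ^ 2 := pow_le_pow_left₀ h0 hlog1 2
  have hk' : d ^ 8 * |k| ≤ 4 * C₀' / Real.log Λ ^ 2 := by
    calc d ^ 8 * |k| ≤ C₀ / Real.log (1 / (t * d)) ^ 2 := hk
      _ ≤ C₀' / Real.log (1 / (t * d)) ^ 2 := div_le_div_of_nonneg_right hC (sq_nonneg _)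
      _ ≤ C₀' / (Real.log Λ ^ 2 / 4) := div_le_div_of_nonneg_left hC0 (by positivity) hlog2
      _ = 4 * C₀' / Real.log Λ ^ 2 := by rw [div_div_eq_mul_div]; ring
  have hkw : |k| ≤ 4 * C₀' / Real.log Λ ^ 2 * (s / σ) ^ 8 :=
    kernel_le_of_pow_mul_le hd hσ hσd (by positivity) hk'
  have hPs : P * (s / σ) ^ 8 ≤ s ^ 8 := mul_div_pow_le hPσ hσ
  have hbb : b₁ * b₂ ≤ c₁ * c₂ := mul_le_mul hb₁ hb₂ hb₂0 (hb₁0.trans hb₁)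
  have hcc : 0 ≤ c₁ * c₂ := (mul_nonneg hb₁0 hb₂0).trans hbb
  calc P * (b₁ * b₂) * |k| ≤ P * (c₁ * c₂) * (4 * C₀' / Real.log Λ ^ 2 * (s / σ) ^ 8) :=
        mul_le_mul (mul_le_mul_of_nonneg_left hbb hP0) hkw (abs_nonneg _) (by positivity)
    _ = 4 * C₀' / Real.log Λ ^ 2 * (P * (s / σ) ^ 8) * (c₁ * c₂) := by ring
    _ ≤ 4 * C₀' / Real.log Λ ^ 2 * s ^ 8 * (c₁ * c₂) :=
        mul_le_mul_of_nonneg_right (mul_le_mul_of_nonneg_left hPs (by positivity)) hcc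
    _ = 4 * C₀' * s ^ 8 / Real.log Λ ^ 2 * (c₁ * c₂) := by ring

/-- TAIL class: the scale-free clause `|k| ≤ C₁ (s/σ)⁸` and a Schwartz tail `b₁ b₂ ≤ (2⁸/Λ⁴) c₁ c₂`. [folklore] -/
theorem est_tail {P σ s d k C₁' Λ b₁ b₂ c₁ c₂ : ℝ} (hP0 : 0 ≤ P) (hPσ : P ≤ σ ^ 8) (hσ : 0 < σ)
    (hd : 0 < d) (hσd : σ ≤ s * d) (hk : d ^ 8 * |k| ≤ C₁') (hC : 0 ≤ C₁')
    (htail : b₁ * b₂ ≤ 2 ^ 8 / Λ ^ 4 * (c₁ * c₂)) (hcc : 0 ≤ c₁ * c₂) :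
    P * (b₁ * b₂) * |k| ≤ 2 ^ 8 * C₁' * s ^ 8 / Λ ^ 4 * (c₁ * c₂) := by
  have hkt : |k| ≤ C₁' * (s / σ) ^ 8 := kernel_le_of_pow_mul_le hd hσ hσd hC hk
  have hPs : P * (s / σ) ^ 8 ≤ s ^ 8 := mul_div_pow_le hPσ hσ
  calc P * (b₁ * b₂) * |k| ≤ P * (2 ^ 8 / Λ ^ 4 * (c₁ * c₂)) * (C₁' * (s / σ) ^ 8) :=
        mul_le_mul (mul_le_mul_of_nonneg_left htail hP0) hkt (abs_nonneg _) (by positivity)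
    _ = 2 ^ 8 / Λ ^ 4 * C₁' * (P * (s / σ) ^ 8) * (c₁ * c₂) := by ring
    _ ≤ 2 ^ 8 / Λ ^ 4 * C₁' * s ^ 8 * (c₁ * c₂) :=
        mul_le_mul_of_nonneg_right (mul_le_mul_of_nonneg_left hPs (by positivity)) hcc
    _ = 2 ^ 8 * C₁' * s ^ 8 / Λ ^ 4 * (c₁ * c₂) := by ring

end Summit.QuantumFields.YangMills.Cruxes.RunningCouplingCeiling.Pointwise

end
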